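import Summits.ResolutionOfSingularities.ResolutionOfSingularities.Theorems.HomologicalConductorNoZenoNodeBlowupResolution
import Literature.AlgebraicGeometry.Resolution.BlowupExceptionalFibreNontrivial
import HarnessLib

/-!
# Crux `NoZenoR` (stmt-ResolutionOfSingularities-19943), slot `stub_L1wCoreF`, (B1) — the subdivision clause for the blow-up of an
# ARBITRARY FINITE SET OF CLOSED POINTS on exceptional curves (the upstairs centre `σ⁻¹(sepNodes π)`)

Route `ResolutionOfSingularities/HomologicalConductor`, crux chain W4.4.  OURS (cell res-hironaka; lead res-L0-w44-lead-1 g9 OBJECTION/CENSUS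
20:23:56Z «GAP-N2»: the subdivision clause is consumed UPSTAIRS, for the base-changed blow-up `ρ_f` whose centre is the finite set
`σ⁻¹(sepNodes π)` of closed points of `X_f` — not literally `sepNodes π_f`; planner res-L0-w44-plan-1 DESK WORDs 18/19, ROUTE M (ρ53d));
AI-written, weaker than expert review; nothing of the manuscript under review (Hironaka 2017) is used and no Theses declaration is
asserted.  Def-free, `--supports 19943 --as helper`.

This file repeats `…NoZenoSubdivisionNodeBlowup` / `…NoZenoNodeBlowupResolution` (p566533 / p568319, centre `sepNodes π`) for a blow-up
`ρ : X¹ → X` of the vanishing ideal of ANY finite set `N` of closed points of `X` each lying on an integral exceptional curve of the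
resolution `π : X → Spec S` (`S` Noetherian local domain of dimension `2`, finitely many exceptional curves), so that the by-name
consumer can take `N = σ⁻¹(sepNodes π)` upstairs (with stub-4's (NODE2-up) `…TwoCurvesUpstairs` as `hsplit` and stub-3's
`incidenceGraph_isAcyclic` for the upstairs resolution as `hG`).  NEW curves: `{n ∈ excCurvePoints (ρ ≫ π) | ρ n ∈ N}`.

* centre: `isClosed_of_finite_of_isClosed_singleton`, `stalkIdeal_eq_maximalIdeal`, `two_le_ringKrullDim_stalk`, `isRegular_centre`,
  `ne_univ`, `vanishingIdeal_ne_bot`;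
* (1δ) for `N`: `isRegular`, `isProper`, `isIntegral`, `isBirational`, **`isResolution_comp : IsResolution (ρ ≫ π)`**;
* node curves: `isIrreducible_fibre`, `fibre_nontrivial` (tree `IsBlowup.nontrivial_preimage_singleton`, p569098),
  **`exists_curve_fibre_eq_closure`** (`∀ z ∈ N, ∃ n ∈ excCurvePoints (ρ ≫ π), ρ⁻¹{z} = closure {n}`), `preimage_singleton_eq_closure`,
  `image_new_eq`, `isClosed_image_new`, `isIso_morphismRestrict_compl_image`, **`excCurvePoints_eq_image`** (`excCurvePoints π = ρ(OLD)`, `ρ`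
  injective on OLD — the lead's `Contraction.*`);
* **`subdivision_finiteCentre`** — every new curve has exactly two neighbours in `incidenceGraph (ρ ≫ π)`, both old, GIVEN
  `(incidenceGraph π).IsAcyclic` and `hsplit : ∀ z ∈ N, ∃ a ≠ b ∈ excCurvePoints π, a ⤳ z ∧ b ⤳ z` (the «two distinct curves through
  each centre point» input — (NODE2-up) upstairs).

References: Q. Liu (2002) Thm. 8.1.19 [`Liu2002`]; Görtz–Wedhorn I Prop. 13.91/13.96 [`GortzWedhorn2020`]; Stacks 02ND/02OS [`StacksProject`];
Hartshorne II 8.24 (b) [`Hartshorne1977`]; J. Lipman, Publ. IHÉS 36 (1969) §24 [`Lipman1969`] (context).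
-/

noncomputable section

-- single-problem summit: the doubled namespace component `ResolutionOfSingularities` is forced
set_option linter.dupNamespace false

namespace Summit.ResolutionOfSingularities.ResolutionOfSingularities.Theorems.NoZeno.ExcCount.FiniteCentreBlowup

open CategoryTheory AlgebraicGeometry TopologicalSpace Topology IsLocalRing
open Literature.AlgebraicGeometry.Resolution Scheme.IdealSheafData

/-- A finite set of closed points is closed. [folklore] -/
theorem isClosed_of_finite_of_isClosed_singleton {X : Scheme.{0}} {N : Set X} (hNfin : N.Finite)
    (hNcl : ∀ z ∈ N, IsClosed ({z} : Set X)) : IsClosed N := by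
  rw [← Set.biUnion_of_singleton N]
  exact hNfin.isClosed_biUnion fun z hz => hNcl z hz

variable {S : Type} [CommRing S] [IsLocalRing S] [IsNoetherianRing S] {X X1 : Scheme.{0}}
  (π : X ⟶ Spec (.of S)) (ρ : X1 ⟶ X) {N : Set X} (hNc : IsClosed N) (hNfin : N.Finite)
  (hNcl : ∀ z ∈ N, IsClosed ({z} : Set X))
  (hNexc : ∀ z ∈ N, ∃ η ∈ excCurvePoints π, η ⤳ z ∧ z ≠ η)

/-! ## The centre -/

omit [IsLocalRing S] [IsNoetherianRing S] in
include hNfin hNcl in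
/-- At a point of the finite centre the stalk of its ideal is `𝔪_z` (tree `stalkIdeal_vanishingIdeal_of_finite`). [folklore] -/
theorem stalkIdeal_eq_maximalIdeal {z : X} (hz : z ∈ N) :
    stalkIdeal (vanishingIdeal (⟨N, hNc⟩ : Closeds X)) z = maximalIdeal (X.presheaf.stalk z) :=
  stalkIdeal_vanishingIdeal_of_finite (Z := ⟨N, hNc⟩) hNfin hNcl hz

omit [IsNoetherianRing S] in
include hNexc in
/-- Every centre point lies over the closed point of `S` (it is a specialisation of an exceptional curve). [folklore] -/
theorem base_eq_closedPoint {z : X} (hz : z ∈ N) : π.base z = closedPoint S := by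
  obtain ⟨η, hη, hsp, -⟩ := hNexc z hz
  exact base_eq_closedPoint_of_specializes π hη.1 hsp

include hNexc in
/-- **`dim 𝒪_{X,z} ≥ 2` at a centre point** of a resolution `π` of the two-dimensional Noetherian local domain `S` (the point lies strictly
below an exceptional curve `η` of `coheight 1`). [folklore] -/
theorem two_le_ringKrullDim_stalk [IsDomain S] (h2 : ringKrullDim S = 2) (hπ : IsResolution π) {z : X} (hz : z ∈ N) :
    2 ≤ ringKrullDim (X.presheaf.stalk z) := by
  obtain ⟨η, hη, h, hne⟩ := hNexc z hz
  have hlt : z < η := lt_iff_le_not_ge.mpr ⟨Scheme.le_iff_specializes.mpr h, fun hge =>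
    hne ((Scheme.le_iff_specializes.mp hge).antisymm h).eq⟩
  have hco : Order.coheight η + 1 ≤ Order.coheight z := Order.coheight_add_one_le hlt
  rw [hπ.coheight_eq_one_of_mem_excCurvePoints h2 hη] at hco
  rw [ringKrullDim_stalk_eq_coheight]
  have h21 : (2 : ℕ∞) ≤ Order.coheight z := by simpa [one_add_one_eq_two] using hco
  exact (WithBot.coe_le_coe.mpr h21 : ((2 : ℕ∞) : WithBot ℕ∞) ≤ (Order.coheight z : WithBot ℕ∞))

omit [IsNoetherianRing S] in
include hNexc in
/-- `𝔪_z ≠ 0` at a centre point (`z` is a proper specialisation, so `𝒪_{X,z}` is not a field). [folklore] -/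
theorem maximalIdeal_stalk_ne_bot {z : X} (hz : z ∈ N) : maximalIdeal (X.presheaf.stalk z) ≠ ⊥ := by
  obtain ⟨η, -, h, hne⟩ := hNexc z hz
  have hlt : z < η := lt_iff_le_not_ge.mpr ⟨Scheme.le_iff_specializes.mpr h, fun hge =>
    hne ((Scheme.le_iff_specializes.mp hge).antisymm h).eq⟩
  have hco : (1 : ℕ∞) ≤ Order.coheight z := le_trans (by simp) (Order.coheight_add_one_le hlt)
  intro hbot
  have h0 : ringKrullDim (X.presheaf.stalk z) = 0 :=
    ringKrullDim_eq_zero_of_isField ((isField_iff_maximalIdeal_eq).mpr hbot)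
  rw [ringKrullDim_stalk_eq_coheight] at h0
  have : Order.coheight z = 0 := by exact_mod_cast h0
  rw [this] at hco
  exact absurd hco (by decide)

omit [IsLocalRing S] in
include hNfin hNcl in
/-- **The finite centre is a regular closed subscheme** (`isRegular_subscheme_vanishingIdeal_of_finite`, p568319). [this work] -/
theorem isRegular_centre [IsProper π] : Scheme.IsRegular (vanishingIdeal (⟨N, hNc⟩ : Closeds X)).subscheme := by
  haveI : IsLocallyNoetherian X := LocallyOfFiniteType.isLocallyNoetherian π
  exact NodeBlowup.isRegular_subscheme_vanishingIdeal_of_finite (Z := ⟨N, hNc⟩) hNfin hNcl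

omit [IsNoetherianRing S] in
include hNcl hNexc in
/-- The centre is not all of `X`: the curve `η` through a centre point is not a closed point, hence not in `N`. [this work] -/
theorem ne_univ [Nonempty X] : N ≠ Set.univ := by
  intro h
  obtain ⟨x⟩ := ‹Nonempty X›
  obtain ⟨η, hη, -, -⟩ := hNexc x (h ▸ Set.mem_univ x)
  have hηcl : IsClosed ({η} : Set X) := hNcl η (h ▸ Set.mem_univ η)
  have h0 := Scheme.height_of_isClosed hηcl
  rw [hη.2] at h0
  exact one_ne_zero h0

omit [IsNoetherianRing S] in
include hNcl hNexc in
/-- The vanishing ideal of the centre is non-zero. [this work] -/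
theorem vanishingIdeal_ne_bot [Nonempty X] : vanishingIdeal (⟨N, hNc⟩ : Closeds X) ≠ ⊥ := by
  intro h
  apply ne_univ π hNcl hNexc
  change ((⟨N, hNc⟩ : Closeds X) : Set X) = Set.univ
  rw [← coe_support_vanishingIdeal (⟨N, hNc⟩ : Closeds X), h, support_bot]
  rfl

/-! ## (1δ) for a finite centre: `X¹ → Spec S` is a resolution -/

omit [IsLocalRing S] in
include hNfin hNcl in
/-- `X¹` is regular (regular centre on a regular `X`; `IsBlowup.isRegular_of_isRegular_subscheme`). [cite: Liu2002, Thm. 8.1.19 (a)] -/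
theorem isRegular [IsProper π] (hX : Scheme.IsRegular X) (hρ : IsBlowup ρ (vanishingIdeal ⟨N, hNc⟩)) : Scheme.IsRegular X1 := by
  haveI : IsLocallyNoetherian X := LocallyOfFiniteType.isLocallyNoetherian π
  exact hρ.isRegular_of_isRegular_subscheme hX (isRegular_centre π hNc hNfin hNcl)

omit [IsLocalRing S] in
/-- `ρ` is proper (`IsBlowup.isProper`). [cite: GortzWedhorn2020, Prop. 13.96 (1)] -/
theorem isProper [IsProper π] (hρ : IsBlowup ρ (vanishingIdeal ⟨N, hNc⟩)) : IsProper ρ := by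
  haveI : IsLocallyNoetherian X := LocallyOfFiniteType.isLocallyNoetherian π
  exact hρ.isProper

omit [IsNoetherianRing S] in
include hNcl hNexc in
/-- `X¹` is integral (`IsBlowup.isIntegral`). [cite: StacksProject, Tag 02ND] -/
theorem isIntegral [IsIntegral X] (hρ : IsBlowup ρ (vanishingIdeal ⟨N, hNc⟩)) : IsIntegral X1 :=
  hρ.isIntegral (vanishingIdeal_ne_bot π hNc hNcl hNexc)

omit [IsNoetherianRing S] in
include hNcl hNexc in
/-- `ρ` is birational (`IsBlowup.isBirational'`). [cite: StacksProject, Tag 02OS] -/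
theorem isBirational [IsIntegral X] (hρ : IsBlowup ρ (vanishingIdeal ⟨N, hNc⟩)) : IsBirational ρ :=
  hρ.isBirational' (vanishingIdeal_ne_bot π hNc hNcl hNexc)

include hNfin hNcl hNexc in
/-- **(1δ) for a finite centre**: `ρ ≫ π` is a resolution (proper ∘ proper, birational ∘ birational, `X¹` regular).
[cite: Liu2002, Thm. 8.1.19 (a)] -/
theorem isResolution_comp [IsDomain S] (hπ : IsResolution π) (hρ : IsBlowup ρ (vanishingIdeal ⟨N, hNc⟩)) :
    IsResolution (ρ ≫ π) := by
  haveI : IsIntegral X := hπ.isIntegral_source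
  haveI : IsProper π := hπ.isProper
  haveI : IsProper ρ := isProper π ρ hNc hρ
  exact ⟨inferInstance, (isBirational π ρ hNc hNcl hNexc hρ).comp hπ.isBirational,
    isRegular π ρ hNc hNfin hNcl hπ.isRegular hρ⟩

/-! ## The new curves: one integral exceptional curve over each centre point -/

omit [IsNoetherianRing S] in
include hNfin hNcl hNexc in
/-- The fibre over a centre point is irreducible (`IsBlowup.isIrreducible_preimage_singleton`). [cite: Hartshorne1977, II Thm. 8.24 (b)] -/
theorem isIrreducible_fibre (hX : Scheme.IsRegular X) (hρ : IsBlowup ρ (vanishingIdeal ⟨N, hNc⟩)) {z : X} (hz : z ∈ N) :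
    IsIrreducible (ρ.base ⁻¹' {z}) := by
  haveI : IsRegularLocalRing (X.presheaf.stalk z) := hX z
  exact hρ.isIrreducible_preimage_singleton z (stalkIdeal_eq_maximalIdeal hNc hNfin hNcl hz)
    (maximalIdeal_stalk_ne_bot π hNexc hz)

include hNfin hNcl hNexc in
/-- The fibre over a centre point has at least two points (`IsBlowup.nontrivial_preimage_singleton`: it is an embedded `ℙ¹_{κ(z)}`).
[cite: Hartshorne1977, II Thm. 8.24 (b)] -/
theorem fibre_nontrivial [IsDomain S] (h2 : ringKrullDim S = 2) (hπ : IsResolution π)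
    (hρ : IsBlowup ρ (vanishingIdeal ⟨N, hNc⟩)) {z : X} (hz : z ∈ N) : (ρ.base ⁻¹' {z}).Nontrivial := by
  haveI : IsRegularLocalRing (X.presheaf.stalk z) := hπ.isRegular z
  exact hρ.nontrivial_preimage_singleton z (stalkIdeal_eq_maximalIdeal hNc hNfin hNcl hz)
    (two_le_ringKrullDim_stalk π hNexc h2 hπ hz)

include hNfin hNcl hNexc in
/-- **One integral exceptional curve over each centre point**: for the blow-up `ρ` of the finite centre `N` on a resolution `π` of the
two-dimensional Noetherian local domain `S`, `∀ z ∈ N, ∃ n ∈ excCurvePoints (ρ ≫ π), ρ⁻¹{z} = closure {n}` (the generic point of the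
irreducible closed fibre: over the closed point, height `≤ 1` as a closed-fibre point of the resolution `ρ ≫ π`, height `≥ 1` since
the fibre has a second point). [cite: Liu2002, Thm. 8.1.19] -/
theorem exists_curve_fibre_eq_closure [IsDomain S] (h2 : ringKrullDim S = 2) (hπ : IsResolution π)
    (hρ : IsBlowup ρ (vanishingIdeal ⟨N, hNc⟩)) :
    ∀ z ∈ N, ∃ n ∈ excCurvePoints (ρ ≫ π), ρ.base ⁻¹' {z} = closure {n} := by
  intro z hz
  have hirr := isIrreducible_fibre π ρ hNc hNfin hNcl hNexc hπ.isRegular hρ hz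
  have hcl : IsClosed (ρ.base ⁻¹' {z}) := (hNcl z hz).preimage ρ.base.hom.continuous
  have hfib : ρ.base ⁻¹' {z} = closure {hirr.genericPoint} := (hirr.closure_genericPoint hcl).symm
  have hnz : ρ.base hirr.genericPoint = z := by
    have : hirr.genericPoint ∈ ρ.base ⁻¹' {z} :=
      (Set.ext_iff.mp hfib _).mpr (subset_closure (Set.mem_singleton _))
    exact this
  have hbase : (ρ ≫ π).base hirr.genericPoint = closedPoint S := by
    change π.base (ρ.base hirr.genericPoint) = closedPoint S
    rw [hnz]; exact base_eq_closedPoint π hNexc hz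
  refine ⟨hirr.genericPoint, ⟨hbase, le_antisymm ?_ ?_⟩, hfib⟩
  · exact (isResolution_comp π ρ hNc hNfin hNcl hNexc hπ hρ).height_le_one_of_base_eq_closedPoint h2 hbase
  · obtain ⟨p, hp, hpn⟩ := (fibre_nontrivial π ρ hNc hNfin hNcl hNexc h2 hπ hρ hz).exists_ne hirr.genericPoint
    have hsp : hirr.genericPoint ⤳ p := by
      rw [hfib] at hp; exact specializes_iff_mem_closure.mpr hp
    have hlt : p < hirr.genericPoint := lt_iff_le_not_ge.mpr ⟨Scheme.le_iff_specializes.mpr hsp, fun hge =>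
      hpn ((Scheme.le_iff_specializes.mp hge).antisymm hsp).eq⟩
    exact le_trans (by simp) (Order.height_add_one_le hlt)

/-! ## The Contraction-shaped clauses for the new curves `{n ∈ excCurvePoints (ρ ≫ π) | ρ n ∈ N}` -/

section Clauses

variable (hcurve : ∀ z ∈ N, ∃ n ∈ excCurvePoints (ρ ≫ π), ρ.base ⁻¹' {z} = closure {n})

omit [IsNoetherianRing S] in
include hcurve in
/-- hfib: an exceptional curve of `ρ ≫ π` over a centre point is THE curve over it. [folklore] -/
theorem preimage_singleton_eq_closure {n : X1} (hn : n ∈ excCurvePoints (ρ ≫ π)) (hz : ρ.base n ∈ N) :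
    ρ.base ⁻¹' {ρ.base n} = closure {n} := by
  obtain ⟨n₀, hn₀, hfib⟩ := hcurve _ hz
  have hmem : n ∈ closure ({n₀} : Set X1) := by rw [← hfib]; exact Set.mem_singleton _
  by_cases hne : n = n₀
  · subst hne; exact hfib
  · exact absurd (specializes_iff_mem_closure.mpr hmem)
      (not_specializes_of_height_eq hne (by rw [hn.2, hn₀.2]) (by rw [hn.2]; exact ENat.coe_lt_top 1))

omit [IsNoetherianRing S] in
include hcurve in
/-- `ρ(NEW) = N`. [folklore] -/
theorem image_new_eq : ρ.base '' {n | n ∈ excCurvePoints (ρ ≫ π) ∧ ρ.base n ∈ N} = N := by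
  ext z
  constructor
  · rintro ⟨n, hn, rfl⟩; exact hn.2
  · intro hz
    obtain ⟨n, hn, hfib⟩ := hcurve z hz
    have hρn : ρ.base n = z := by
      have : n ∈ ρ.base ⁻¹' {z} := by rw [hfib]; exact subset_closure (Set.mem_singleton n)
      exact this
    exact ⟨n, ⟨hn, hρn ▸ hz⟩, hρn⟩

omit [IsNoetherianRing S] in
include hNc hcurve in
/-- hC: `ρ(NEW)` is closed. [this work] -/
theorem isClosed_image_new : IsClosed (ρ.base '' {n | n ∈ excCurvePoints (ρ ≫ π) ∧ ρ.base n ∈ N}) := by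
  rw [image_new_eq π ρ hcurve]; exact hNc

omit [IsNoetherianRing S] in
include hcurve in
/-- hiso: `ρ` is an isomorphism off `ρ(NEW) = N` = the centre (`IsBlowup.isIso_morphismRestrict`). [cite: GortzWedhorn2020, Prop. 13.91] -/
theorem isIso_morphismRestrict_compl_image (hρ : IsBlowup ρ (vanishingIdeal ⟨N, hNc⟩))
    (hC : IsClosed (ρ.base '' {n | n ∈ excCurvePoints (ρ ≫ π) ∧ ρ.base n ∈ N})) :
    IsIso (ρ ∣_ (⟨(ρ.base '' {n | n ∈ excCurvePoints (ρ ≫ π) ∧ ρ.base n ∈ N})ᶜ, hC.isOpen_compl⟩ : X.Opens)) := by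
  refine hρ.isIso_morphismRestrict ?_
  change Disjoint (ρ.base '' {n | n ∈ excCurvePoints (ρ ≫ π) ∧ ρ.base n ∈ N})ᶜ
    ((vanishingIdeal (⟨N, hNc⟩ : Closeds X)).support : Set X)
  rw [coe_support_vanishingIdeal, image_new_eq π ρ hcurve]
  exact disjoint_compl_left

omit [IsNoetherianRing S] in
include hNcl hcurve in
/-- **`excCurvePoints π = ρ(OLD)`** and `ρ` injective on OLD (the lead's `Contraction.excCurvePoints_eq_image` / `injOn_excCurvePoints_diff`).
[folklore] -/
theorem excCurvePoints_eq_image [IsProper π] [IsProper ρ] (hρ : IsBlowup ρ (vanishingIdeal ⟨N, hNc⟩))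
    (hht : ∀ w : X1, (ρ ≫ π).base w = closedPoint S → Order.height w ≤ 1) :
    excCurvePoints π = ρ.base '' (excCurvePoints (ρ ≫ π) \ {n | n ∈ excCurvePoints (ρ ≫ π) ∧ ρ.base n ∈ N}) ∧
      Set.InjOn ρ.base (excCurvePoints (ρ ≫ π) \ {n | n ∈ excCurvePoints (ρ ≫ π) ∧ ρ.base n ∈ N}) := by
  have hC := isClosed_image_new π ρ hNc hcurve
  have hiso := isIso_morphismRestrict_compl_image π ρ hNc hcurve hρ hC
  exact ⟨Contraction.excCurvePoints_eq_image (ρ ≫ π) π ρ rfl (fun n hn => hn.1)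
      (fun n hn => preimage_singleton_eq_closure π ρ hcurve hn.1 hn.2) hC hiso hht (fun n hn => hNcl _ hn.2),
    Contraction.injOn_excCurvePoints_diff (ρ ≫ π) ρ (fun n hn => hn.1)
      (fun n hn => preimage_singleton_eq_closure π ρ hcurve hn.1 hn.2) hC hiso⟩

omit [IsNoetherianRing S] in
include hNcl hcurve in
/-- The subdivision clause for a finite centre, with the node curves GIVEN (`hcurve`). [cite: Lipman1969, §24 (p. 258)] -/
theorem subdivision_of_curves [IsProper π] [IsProper ρ] (hρ : IsBlowup ρ (vanishingIdeal ⟨N, hNc⟩))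
    (hht : ∀ w : X1, (ρ ≫ π).base w = closedPoint S → Order.height w ≤ 1)
    (hG : (incidenceGraph π).IsAcyclic)
    (hsplit : ∀ z ∈ N, ∃ a b : X, a ∈ excCurvePoints π ∧ b ∈ excCurvePoints π ∧ a ≠ b ∧ a ⤳ z ∧ b ⤳ z) :
    ∀ n ∈ {n | n ∈ excCurvePoints (ρ ≫ π) ∧ ρ.base n ∈ N}, ∃ a b : X1,
      a ∈ excCurvePoints (ρ ≫ π) \ {n | n ∈ excCurvePoints (ρ ≫ π) ∧ ρ.base n ∈ N} ∧
      b ∈ excCurvePoints (ρ ≫ π) \ {n | n ∈ excCurvePoints (ρ ≫ π) ∧ ρ.base n ∈ N} ∧ a ≠ b ∧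
      (incidenceGraph (ρ ≫ π)).Adj n a ∧ (incidenceGraph (ρ ≫ π)).Adj n b ∧
      ∀ c : X1, (incidenceGraph (ρ ≫ π)).Adj n c → c = a ∨ c = b := by
  have hC := isClosed_image_new π ρ hNc hcurve
  have hiso := isIso_morphismRestrict_compl_image π ρ hNc hcurve hρ hC
  exact Subdivision.subdivision_clause_of_isAcyclic (ρ ≫ π) π ρ rfl (fun n hn => hn.1)
    (fun n hn => preimage_singleton_eq_closure π ρ hcurve hn.1 hn.2) hC hiso
    (fun n hn => hNcl _ hn.2) hht hG (fun n hn => hsplit _ hn.2)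

end Clauses

/-! ## Assembly: the subdivision clause for the blow-up of a finite centre of a resolution -/

/-- **THE SUBDIVISION CLAUSE FOR A FINITE CENTRE.**  `π : X → Spec S` a resolution of the Noetherian local domain `S` of dimension `2`
with finitely many integral exceptional curves (hypothesis kept only through `[IsProper π]`-free fields of `hπ`); `N` a finite set of
closed points of `X` through each of which two DISTINCT exceptional curves pass (`hsplit` — stub-4's (NODE2-up) upstairs);
`ρ : X¹ → X` a blow-up of the vanishing ideal of `N`; `incidenceGraph π` acyclic (UP-6).  THEN every exceptional curve of `ρ ≫ π` over a
point of `N` has EXACTLY TWO neighbours in `incidenceGraph (ρ ≫ π)`, both old. [cite: Lipman1969, §24 (p. 258)] -/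
theorem subdivision_finiteCentre [IsDomain S] (h2 : ringKrullDim S = 2) (hπ : IsResolution π)
    (hρ : IsBlowup ρ (vanishingIdeal ⟨N, hNc⟩)) (hNfin : N.Finite) (hNcl : ∀ z ∈ N, IsClosed ({z} : Set X))
    (hG : (incidenceGraph π).IsAcyclic)
    (hsplit : ∀ z ∈ N, ∃ a b : X, a ∈ excCurvePoints π ∧ b ∈ excCurvePoints π ∧ a ≠ b ∧ a ⤳ z ∧ b ⤳ z) :
    ∀ n ∈ {n | n ∈ excCurvePoints (ρ ≫ π) ∧ ρ.base n ∈ N}, ∃ a b : X1,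
      a ∈ excCurvePoints (ρ ≫ π) \ {n | n ∈ excCurvePoints (ρ ≫ π) ∧ ρ.base n ∈ N} ∧
      b ∈ excCurvePoints (ρ ≫ π) \ {n | n ∈ excCurvePoints (ρ ≫ π) ∧ ρ.base n ∈ N} ∧ a ≠ b ∧
      (incidenceGraph (ρ ≫ π)).Adj n a ∧ (incidenceGraph (ρ ≫ π)).Adj n b ∧
      ∀ c : X1, (incidenceGraph (ρ ≫ π)).Adj n c → c = a ∨ c = b := by
  -- every centre point lies on a curve and is not that curve (it is closed, the curve is not)
  have hNexc : ∀ z ∈ N, ∃ η ∈ excCurvePoints π, η ⤳ z ∧ z ≠ η := by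
    intro z hz
    obtain ⟨a, -, ha, -, -, haz, -⟩ := hsplit z hz
    refine ⟨a, ha, haz, fun h => ?_⟩
    have h0 := Scheme.height_of_isClosed (hNcl z hz)
    rw [h, ha.2] at h0
    exact one_ne_zero h0
  haveI : IsProper π := hπ.isProper
  haveI : IsProper ρ := isProper π ρ hNc hρ
  have hres := isResolution_comp π ρ hNc hNfin hNcl hNexc hπ hρ
  exact subdivision_of_curves π ρ hNc hNcl (exists_curve_fibre_eq_closure π ρ hNc hNfin hNcl hNexc h2 hπ hρ) hρ
    (fun w hw => hres.height_le_one_of_base_eq_closedPoint h2 hw) hG hsplit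

end Summit.ResolutionOfSingularities.ResolutionOfSingularities.Theorems.NoZeno.ExcCount.FiniteCentreBlowup

end
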